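import Mathlib.Tactic.Linarith
import Mathlib.Tactic.NormNum
import Mathlib.Tactic.Ring
import Mathlib.Tactic.LinearCombination
import HarnessLib

/-!
# The (0,1) cell of the ι-window, XXXII: the product ground `B₁ × B₂`, XIX — THE CORNER III: the CORRECTION of [XXXI] 12.4 and THEOREM E-VOID
# (report [XXXII] `H2-ZERO-ONE-32.md`): arithmetic shadows

Family `hodge`, b2b cell `hweil` (helper of item stmt-HodgeConjecture-2524). Report
`run/shared/lean/b2b/hodge-weil/b2b-hweil-pv1-g44/H2-ZERO-ONE-32.md` ([XXXII]). Context: the corner `(2Θ_{κ₁}, 2Θ_{κ₂})` of the H2 class on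
`X₀ = B₁ × B₂`; a DIVISORIAL RIBBON HALF along `V` has box pieces `G[x] = (d₁,n₁)`, `Ḡ = (d₂,n₂)` (line bundles on `V = C₁ × B₂`), `d₁ + d₂ = 4`,
cosupport divisor `E`, `(e₁,e₂) = (d₁−d₂+2, n₁−n₂) = (2d₁−2, δ)`; the (red) partner is `i_{H*}𝓠`, `𝓠` of rank 2 on `H`, Chern data `(n′, d′, m′, μ′)`
with `c₁ = n′θ₁ + d′f′`, `c₂ = m′ϖ′ + μ′f′θ₁` ([XXXI] 5.1). (1) CORRECTION: by the certified equations (E3a)/(E3b) of [XXX] 5.3 (two H-boxes: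
`n′² − m′ = n₃² + n₄²`, `n′d′ − μ′ − n′ = n₃(d₃−1) + n₄(d₄−1)`) the class equation reads `m′ = n′² + A`, `μ′ = 3n′ + B` with
`A := n₁(d₁−1) + n₂(d₂−1)`, `B := n₁² + n₂²` — [XXXI] 12.4 had `A` and `B` interchanged —, and the top-degree equation is
`2P = (σ−1)((σ−1)² + δ² + 3 + 2(d₁−2)δ)` with a POSITIVE second factor: `σ = 1` (FAMILY II) is the ONLY solution family; 'family I' of [XXXI] 12.4
violates the class equation except at its member `n = 0` (which is family II's `(1,1),(3,0)`); family II's partner numerics are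
`(n′, d′, m′, μ′) = (1, 4, 2 + (d₁−2)(2n₁−1), 2n₁² − 2n₁ + 4)`; RIB-4B∞ (b) re-proved. (2) THEOREM E-VOID (dimension bookkeeping only): every corner
sheaf of family II has `e₁^ι ≥ 3`. HONEST FRAMING: census results inside the ladder's H2 test ((0,1) cell) on the SPECIAL fourfold `X₀`; nothing
here is a rung; no case of the Hodge conjecture is proved; no statement of [Markman 2025] / [Perry 2026] / [EdGFS 2025] is used. Every theorem is a
def-free arithmetic statement that the report cites at the step named in its docstring; none claims geometry.
-/

-- mandated namespace `Summit.HodgeConjecture.HodgeConjecture.…` (Problem = Summit) trips `linter.dupNamespace`; the lakefile disables it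
-- tree-wide (weak option), restated here so stand-alone elaboration is warning-free too.
set_option linter.dupNamespace false

namespace Summit.HodgeConjecture.HodgeConjecture.WeilTypeLadder

section ProductGroundNineteen

/-- **[XXXII] 2.1 (which Chern number pairs with which coefficient — the certified two-box check).** For two H-boxes `N₃ ⊠ λ₃ ⊕ N₄ ⊠ λ₄`
(`(n′, d′, m′, μ′) = (n₃+n₄, d₃+d₄, 2n₃n₄, n₃d₄+n₄d₃)`, [XXXI] 5.1) with `d₃ + d₄ = 4`: the `t₁²t₂`-coefficient `(n′² − m′)/2` of `ch(i_{H*}𝓠)` equals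
`(n₃² + n₄²)/2` — the H-part of [XXX] 5.3 (E3a) — and the `t₁t₂²`-coefficient `(n′d′ − μ′ − n′)/2` equals `(n₃(d₃−1) + n₄(d₄−1))/2` — the H-part of
(E3b). Hence against two V-boxes `(d₁,n₁),(d₂,n₂)`: (E3a) `n₁(d₁−1) + n₂(d₂−1) + n′² − m′ = 0`, (E3b) `n₁² + n₂² + n′d′ − μ′ − n′ = 0`, i.e.
**`m′ = n′² + A`, `μ′ = 3n′ + B`** (`d′ = 4`). [`ring` / `linear_combination`] -/
theorem pg19_E3_pairing :
    ∀ n₃ n₄ d₃ d₄ : ℤ, d₃ + d₄ = 4 →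
      ((n₃ + n₄) ^ 2 - 2 * n₃ * n₄ = n₃ ^ 2 + n₄ ^ 2) ∧
      ((n₃ + n₄) * 4 - (n₃ * d₄ + n₄ * d₃) - (n₃ + n₄) = n₃ * (d₃ - 1) + n₄ * (d₄ - 1)) := by
  intro n₃ n₄ d₃ d₄ h
  exact ⟨by ring, by linear_combination (-(n₃ + n₄)) * h⟩

/-- **[XXXII] 2.2 CORRECTION (the (E-rib, red-bundle) top-degree equation with the right assignment).** With `d₂ = 4 − d₁`, `n′ = 2 − n₁ − n₂`,
`A = n₁(d₁−1) + n₂(d₂−1)`, `B = n₁² + n₂²`, `C = n₁²(d₁−1) + n₂²(d₂−1)`, `m′ = n′² + A`, `μ′ = 3n′ + B`, the top-degree equation (E4)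
`C + 3n′² − n′μ′ − m′ = −2` has left side minus right side `P = C − A − n′B − n′² + 2`, and
**`2P = (σ − 1)·((σ − 1)² + δ² + 3 + 2(d₁ − 2)δ)`**, `σ = n₁ + n₂`, `δ = n₁ − n₂`. (Contrast [XXXI] 12.4 / `pg18a_factor`, which — with `A`, `B`
interchanged — factorised the wrong polynomial as `2(σ−1)((d₁−2)δ+1)`.) [`ring`] -/
theorem pg19_top_degree_factorisation :
    ∀ d₁ n₁ n₂ : ℤ,
      2 * ((n₁ ^ 2 * (d₁ - 1) + n₂ ^ 2 * ((4 - d₁) - 1)) + 3 * (2 - n₁ - n₂) ^ 2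
            - (2 - n₁ - n₂) * (3 * (2 - n₁ - n₂) + (n₁ ^ 2 + n₂ ^ 2))
            - ((2 - n₁ - n₂) ^ 2 + (n₁ * (d₁ - 1) + n₂ * ((4 - d₁) - 1))) + 2)
        = ((n₁ + n₂) - 1) * (((n₁ + n₂) - 1) ^ 2 + (n₁ - n₂) ^ 2 + 3 + 2 * (d₁ - 2) * (n₁ - n₂)) := by
  intro d₁ n₁ n₂
  ring

/-- **[XXXII] 2.2 (the second factor is positive on the ribbon-ordered range).** For `δ = n₁ − n₂ = e₂ ≥ 0` and `d₁ ≥ 1` (`e₁ = 2d₁ − 2 ≥ 0`):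
`(σ−1)² + δ² + 3 + 2(d₁−2)δ = (σ−1)² + (δ−1)² + 2 + 2(d₁−1)δ > 0`. Hence `P = 0 ⟹ σ = 1`: **the (E-rib, red-bundle) rows are FAMILY II
(`n₁ + n₂ = 1`, `n′ = 1`) and nothing else** — 'family I' of [XXXI] 12.4 (pieces `(1, n+1), (3, n)`) violates the class equation unless `n = 0`.
[`nlinarith`] -/
theorem pg19_family_two_only :
    (∀ s δ d : ℤ, 0 ≤ δ → 1 ≤ d → 0 < (s - 1) ^ 2 + δ ^ 2 + 3 + 2 * (d - 2) * δ) ∧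
    (∀ d₁ n₁ n₂ : ℤ, 0 ≤ n₁ - n₂ → 1 ≤ d₁ →
      ((n₁ + n₂) - 1) * (((n₁ + n₂) - 1) ^ 2 + (n₁ - n₂) ^ 2 + 3 + 2 * (d₁ - 2) * (n₁ - n₂)) = 0 → n₁ + n₂ = 1) ∧
    (∀ n : ℤ, (((n + 1) + n) - 1) * ((((n + 1) + n) - 1) ^ 2 + ((n + 1) - n) ^ 2 + 3 + 2 * ((1:ℤ) - 2) * ((n + 1) - n)) = 0 → n = 0) := by
  have pos : ∀ s δ d : ℤ, 0 ≤ δ → 1 ≤ d → 0 < (s - 1) ^ 2 + δ ^ 2 + 3 + 2 * (d - 2) * δ := by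
    intro s δ d hδ hd
    nlinarith [sq_nonneg (s - 1), sq_nonneg (δ - 1), mul_nonneg (by linarith : (0:ℤ) ≤ d - 1) hδ]
  refine ⟨pos, fun d₁ n₁ n₂ hδ hd h => ?_, fun n h => ?_⟩
  · rcases mul_eq_zero.mp h with h1 | h2
    · linarith
    · exact absurd h2 (ne_of_gt (pos (n₁ + n₂) (n₁ - n₂) d₁ hδ hd))
  · rcases mul_eq_zero.mp h with h1 | h2
    · linarith
    · exact absurd h2 (ne_of_gt (pos ((n + 1) + n) ((n + 1) - n) 1 (by norm_num) le_rfl))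

/-- **[XXXII] 2.3 (family II's partner numerics, corrected).** Pieces `(d₁, n₁) = G[x]`, `(4 − d₁, 1 − n₁) = Ḡ`: `n′ = 1`, `d′ = 4`,
`(e₁, e₂) = (2d₁ − 2, 2n₁ − 1)` (odd), **`m′ = n′² + A = 2 + (d₁ − 2)(2n₁ − 1)`**, **`μ′ = 3n′ + B = 2n₁² − 2n₁ + 4`**, and (E4) holds identically;
the Euler characteristics used in 2.4: on a fibre `B₁ × {z}`, `χ(𝓠_z) = n′² − m′ = −1 − (d₁−2)(2n₁−1)`; on `H`, `χ(𝓠) = 3n′² − m′ − n′μ′ =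
−3 − (d₁−2)(2n₁−1) − 2n₁(n₁−1)`. [`ring`] -/
theorem pg19_family_two_numerics :
    ∀ d₁ n₁ : ℤ,
      (2 - n₁ - (1 - n₁) = 1) ∧ (n₁ - (1 - n₁) = 2 * n₁ - 1) ∧
      ((1:ℤ) ^ 2 + (n₁ * (d₁ - 1) + (1 - n₁) * ((4 - d₁) - 1)) = 2 + (d₁ - 2) * (2 * n₁ - 1)) ∧
      (3 * (1:ℤ) + (n₁ ^ 2 + (1 - n₁) ^ 2) = 2 * n₁ ^ 2 - 2 * n₁ + 4) ∧
      ((n₁ ^ 2 * (d₁ - 1) + (1 - n₁) ^ 2 * ((4 - d₁) - 1)) + 3 * (1:ℤ) ^ 2 - 1 * (2 * n₁ ^ 2 - 2 * n₁ + 4)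
          - (2 + (d₁ - 2) * (2 * n₁ - 1)) = -2) ∧
      ((1:ℤ) ^ 2 - (2 + (d₁ - 2) * (2 * n₁ - 1)) = -1 - (d₁ - 2) * (2 * n₁ - 1)) ∧
      (3 * (1:ℤ) ^ 2 - (2 + (d₁ - 2) * (2 * n₁ - 1)) - 1 * (2 * n₁ ^ 2 - 2 * n₁ + 4) = -3 - (d₁ - 2) * (2 * n₁ - 1) - 2 * n₁ * (n₁ - 1)) := by
  intro d₁ n₁
  refine ⟨by ring, by ring, by ring, by ring, by ring, by ring, by ring⟩

/-- **[XXXII] 2.4 REMARK (holomorphic Lefschetz on a fibre `B₁ × {z}`, `z ∈ C₂[2]`, is consistent and gives no constraint).** `ι` acts on `𝓠_z`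
as a scalar `±1` at the six points of `C₁[2] × {z}` and tracelessly at the other ten, so `L(ι, 𝓠_z) = (1/4)Σ tr = ±(3 − neg)` with `neg` the number
of Weierstrass points where `Ḡ`'s `C₁`-factor `λ₂` (degree `4 − d₁`) has character `−1`, `neg ≡ 4 − d₁ ≡ d₁ (mod 2)`; `L ≡ χ(𝓠_z) = 1 − m′ (mod 2)`
holds identically: writing `neg = d₁ + 2k`, `(3 − neg) − (1 − m′) = 2(3 − d₁ − k + (d₁−2)n₁)`. [`ring`] -/
theorem pg19_lefschetz_parity :
    ∀ d₁ n₁ k : ℤ, (3 - (d₁ + 2 * k)) - (1 - (2 + (d₁ - 2) * (2 * n₁ - 1))) = 2 * (3 - d₁ - k + (d₁ - 2) * n₁) := by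
  intro d₁ n₁ k
  ring

/-- **[XXXII] 2.5 THEOREM RIB-4B∞ (b), re-proved with the corrected numerics.** A two-box (red) H-half `N₃ ⊠ λ₃ ⊕ N₄ ⊠ λ₄` against a family-II
V-half needs `n₃ + n₄ = n′ = 1` and `2n₃n₄ = m′ = 2 + (d₁−2)(2n₁−1)` (`d₁ ≥ 1`, `n₁ ≥ 1`): impossible — `n₃(1−n₃) ≤ 0` for integers, so `d₁ ≥ 2`
is excluded by sign (`m′ ≥ 2`) and `d₁ = 1` by parity (`m′ = 3 − 2n₁` odd). [cases; `nlinarith`; divisibility] -/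
theorem pg19_two_box_partner_excluded :
    ∀ d₁ n₁ n₃ : ℤ, 1 ≤ d₁ → 1 ≤ n₁ → 2 * n₃ * (1 - n₃) ≠ 2 + (d₁ - 2) * (2 * n₁ - 1) := by
  intro d₁ n₁ n₃ hd hn h
  have hprod : n₃ * (1 - n₃) ≤ 0 := by
    rcases le_or_gt n₃ 0 with h0 | h0
    · nlinarith
    · nlinarith
  rcases eq_or_lt_of_le hd with h1 | h1
  · subst h1
    have hdvd : (2:ℤ) ∣ 2 * n₃ * (1 - n₃) := ⟨n₃ * (1 - n₃), by ring⟩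
    rw [h] at hdvd
    rcases hdvd with ⟨j, hj⟩
    omega
  · have hnn : 0 ≤ (d₁ - 2) * (2 * n₁ - 1) := mul_nonneg (by linarith) (by linarith)
    nlinarith

/-- **[XXXII] 4.3 / 4.4 (the dimension bookkeeping of THEOREM E-VOID).** The affine space `A` of admissible sections of `𝒪_V(E − S)` contains
`H⁰(K₁^{d₁−1})^{(x)} ⊗ s_{κ₂}·H⁰((2Θ₀)^{m})^{+}` of dimension `d₁·(2m² + 2)` (`m = n₁ − 1`): for `n₁ ≥ 2`, `dim A ≥ 4d₁ ≥ 4`, so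
`e₁^ι ≥ dim A − 1 ≥ 3`; for `n₁ = 1` the cosupports form `ℙ^{d₁−1}` and the ribbon twists add an orbit of dimension `3 − dim K_E =
3, 2, 1, 0` for `d₁ = 1, 2, 3, ≥ 4` (`dim K_E = 3 − h⁰(K^{3−d₁})`), total `≥ 3` in every case. [`nlinarith` / `norm_num` / `omega`] -/
theorem pg19_evoid_dimensions :
    (∀ d₁ m : ℤ, 1 ≤ d₁ → 1 ≤ m → 4 * d₁ ≤ d₁ * (2 * m ^ 2 + 2) ∧ 4 ≤ 4 * d₁ ∧ 3 ≤ d₁ * (2 * m ^ 2 + 2) - 1) ∧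
    ((0:ℤ) + (3 - 0) = 3 ∧ (1:ℤ) + (3 - 1) = 3 ∧ (2:ℤ) + (3 - 2) = 3 ∧ ∀ d₁ : ℤ, 4 ≤ d₁ → 3 ≤ (d₁ - 1) + (3 - 3)) := by
  refine ⟨fun d₁ m hd hm => ?_, by norm_num, by norm_num, by norm_num, fun d₁ hd => by omega⟩
  have hm2 : 1 ≤ m ^ 2 := by nlinarith
  refine ⟨by nlinarith, by linarith, by nlinarith⟩

/-- **[XXXII] 4.2 (degree bookkeeping behind the vanishing / eigen-dimension statements).** On a genus-2 curve (`2g − 2 = 2`):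
`deg K^{2n₁−1} = 4n₁ − 2 > 2` for `n₁ ≥ 2` (so `H¹(C₂, K₂^{2n₁−1}) = 0`), `deg K^{d₁−2} > 2 ⟺ d₁ ≥ 4` (so `H¹(C₁, K₁^{d₁−2}) = 0` iff `d₁ ≥ 4`);
`h⁰(K^k) = 2k − 1 = (k+1) + (k−2)` for `k ≥ 2` (the `x`-type and `y`-type eigenspaces `x^i(dx/y)^k`, `0 ≤ i ≤ k`, and `y·x^i(dx/y)^k`,
`0 ≤ i ≤ k−3`); `h⁰(B, 𝒪(2mΘ₀)) = 4m² = (2m²+2) + (2m²−2)` (even and odd parts). [`omega` / `ring`] -/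
theorem pg19_degree_bookkeeping :
    (∀ n₁ : ℤ, 2 ≤ n₁ → 2 < 2 * (2 * n₁ - 1)) ∧
    (∀ d₁ : ℤ, 2 < 2 * (d₁ - 2) ↔ 4 ≤ d₁) ∧
    (∀ k : ℤ, 2 ≤ k → 2 * k - 1 = (k + 1) + (k - 2)) ∧
    (∀ m : ℤ, 4 * m ^ 2 = (2 * m ^ 2 + 2) + (2 * m ^ 2 - 2)) := by
  refine ⟨fun n₁ h => by omega, fun d₁ => by omega, fun k _ => by ring, fun m => by ring⟩

end ProductGroundNineteen

end Summit.HodgeConjecture.HodgeConjecture.WeilTypeLadder
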